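import Summits.HodgeConjecture.HodgeConjecture.Theorems.F0P3bInducedCharTransferLeviDictionary   -- ★ p842672∕p842974 (F0P3b-p01 (g7)): (L2)+(L3) dictionaries
import Literature.NumberTheory.Rogawski1990.LocalDeltaTransferLeviStratum                        -- ★ p842593 S3-A: one-term transfer on the Levi stratum
import Literature.NumberTheory.Rogawski1990.FinExplicitTransferFactorLeviStratumFrame            -- ★ p842634 S3-B: `Δ‴ = τ·D·ε` through the frame
import HarnessLib

/-!
# Lemma 4.9.2 on the Levi stratum of an INNER form — the SIGNED pointwise integrand identity `Φ_H(γ_H) = ε_v(H) · Φ_G(ι_v γ_H)`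
(Rogawski (1990), §4.9 Lemma 4.9.2 p. 56 («`D_H(γ)Φ(γ, f^H) = μ(γ)D_G(γ)Φ(γ, f)`»), Prop. 4.9.1 p. 55; §12.1 p. 171; §14.6 p. 242 («`κ(γ, ψ_v(i(γ))) = ±1`»))

Cell `pub/hodgecm-mathlib`, crux H413 `stmt-HodgeConjecture-24833`, line «CMCharIdentityTest» (F0P3b) ED. 14, stub (N-492S) `stub_inducedCharTransferSigned`; desk F0P3b-plan (g12)
PLAN v14 §10 road S0–S4, seat F0P3b-p01 (g7); the (P) sub-brick for the S4 closer of B-p18 (g32).  THEOREMS ONLY (no definition, no `sorry`; `maxHeartbeats 400000` on the one theorem, see the comment there).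
HONEST LABEL: HC_CM is proved only modulo the 2 remaining named inputs (hLiu418, h413) until rung 0 closes.

WHAT.  Van Dijk's formula writes both traces of (N-492S) as canonically normalised torus integrals, `Tr i_H(χ_H)(f^H) = μ(T_H∩K_H)⁻¹ ∫_{T_H} Φ_H` and
`Tr i_G(χ_ξ)(f∘e⁻¹) = μ(T∩K)⁻¹ ∫_{T} Φ_G`, with integrands `Φ_H(γ_H) = χ_H(γ_H) · δ_{B_H}^{1∕2}(γ_H) · J_H(γ_H)⁻¹ · O^H_{γ_H}(f^H)` and
`Φ_G(t) = χ_ξ(t) · δ_B^{1∕2}(t) · J(t)⁻¹ · O_{e t}(f)` (S1 ★, FILE 2 ∕ 2′ ★, `J_H⁻¹ = √‖b − 1‖`, `J⁻¹ = ‖a − 1‖·√‖b − 1‖` after ★ `twistModule_cmLocal_two_eq` ∕ ★ `twistModule_cmLocal_eq`).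
**`leviIntegrand_eq_signed`**: for a `Δ‴`-matched test pair `(f^H, f)` and `γ_H = (diag(d′₀, d′₁), u)` `G`-regular on the stratum,
`Φ_H(γ_H) = ε_v(H) · Φ_G(ι_v γ_H)` with `ε_v(H) = +1` iff the frame multiplier `a` is a norm — assembled from ★ S3-A (`O^H = Δ‴ · O^G`, one term), ★ S3-B
(`Δ‴ = τ_v · D_{G∕H,v} · ε`), ★ (L2) (`χ_H · τ_v = χ_ξ ∘ ι_v`) and ★ (L3) (`δ_{B_H}^{1∕2} J_H⁻¹ D_{G∕H} = δ_B^{1∕2} J⁻¹`) by one `linear_combination`.  With ★ (T)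
`EndoscopicLeviTorusTransport` (the change of variables `T_H ≃ T₃`) this is the integrand-level content of `stub_inducedCharTransferSigned`.
-/

set_option autoImplicit false
set_option linter.dupNamespace false

noncomputable section

open MeasureTheory Measure Set NumberField IsDedekindDomain Matrix
open Literature.NumberTheory.Automorphic Literature.NumberTheory.Automorphic.UnitaryGroup
open Literature.NumberTheory.GaloisRepresentations Literature.NumberTheory.Rogawski1990
open scoped NNReal Matrix MatrixGroups

namespace Summit.HodgeConjecture.HodgeConjecture.Cruxes.H413.F0P3bInducedCharTransferLeviIntegrand

open F0P3bInducedCharTransferLeviDictionary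

variable (L : Type) [Field L] [NumberField L] [IsCMField L]

/-- `((if P then 1 else −1 : ℤ) : ℂ) = if P then 1 else −1` (cast of the sign token of ★ S3-B to the `ℂ`-valued token of the line's ED. 14). [cite: Rogawski1990, §14.6 p. 242] -/
private theorem int_cast_ite_one_neg_one (P : Prop) [Decidable P] : (((if P then 1 else -1 : ℤ)) : ℂ) = if P then (1 : ℂ) else -1 := by
  split_ifs <;> simp

set_option maxHeartbeats 400000 in -- the statement alone is ≈ 60 lines of tokens: each `rw`∕`simp only` pass over the goal costs ≈ 10⁵ heartbeats (measured: fails at 2·10⁵, passes at 4·10⁵)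
open scoped Classical in
/-- **LEMMA 4.9.2 ON THE LEVI STRATUM OF AN INNER FORM — THE SIGNED INTEGRAND IDENTITY.**  Non-split or split `v`, inner form `U(H)` read through the frame
`e = cmDatumLocalCongr L v T₀ ha₀ h` (`ᵗ(T̄₀) H_v T₀ = a • Φ₃`), `Δ‴_v`-matched test pair `(f^H, f)` (★ `IsLocalDeltaTransfer` at ★ `finExplicitCollection`), and
`γ_H = (diag(d′₀, d′₁), u)` `G`-regular on the stratum (all `dᵢ − dⱼ` units for `d = (d′₀, u, d′₁)`; `a − 1 = d′₀⁻¹u − 1`, `b − 1 = d′₀⁻¹d′₁ − 1`), `μ|_{F_v^×} = ω`: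
`χ_{H,2}(g) · ψ(det u) · δ_{B₂}^{1∕2}(g) · √‖b − 1‖ · O^H_{γ_H}(f^H) = ε · (χ_ξ(ι_v γ_H) · δ_B^{1∕2}(ι_v γ_H) · (‖a − 1‖·√‖b − 1‖) · O_{e(ι_v γ_H)}(f))` with
`ε = +1` if `a` is a norm `z σ(z)` and `−1` otherwise.  Print: «`D_H(γ)Φ(γ, f^H) = μ(γ)D_G(γ)Φ(γ, f)` … on `M` the `κ`-orbital integral is the ordinary one» — for the
quasi-split group; for the inner form the `κ`-sign `ε_v(H)` of ★ `finKappaAt_cmDatumLocalCongr_endoEmbLocal_eq_ite` appears.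
[cite: Rogawski1990, §4.9 Lemma 4.9.2 p. 56; Prop. 4.9.1 p. 55; §12.1 p. 171; §14.6 p. 242] -/
theorem leviIntegrand_eq_signed (H : Matrix (Fin 3) (Fin 3) L) (hH : (H.map (IsCMField.complexConj L))ᵀ = H) (hHd : IsUnit H.det)
    {v : HeightOneSpectrum (𝓞 ↥(maximalRealSubfield L))} (w : UnitaryGroup.PlacesOver L v) (hw : IsCMField.complexConj L • w.1 = w.1)
    (T₀ : GL (Fin 3) (UnitaryGroup.LocalRing L v)) {a : UnitaryGroup.LocalRing L v} (ha₀ : IsUnit a)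
    (h : formCongr (conjLocal L (IsCMField.complexConj L) v) T₀ (H.map (algebraMap L (UnitaryGroup.LocalRing L v))) =
      a • (Matrix.of fun i j : Fin 3 => if i.val + j.val + 1 = 3 then (1 : L) else 0).map (algebraMap L (UnitaryGroup.LocalRing L v)))
    [∀ γ : ((cmDatum L 3 H).Local v), MeasurableSpace (((cmDatum L 3 H).Local v) ⧸ Subgroup.centralizer ({γ} : Set ((cmDatum L 3 H).Local v)))]
    [∀ a : ((cmDatum L 2 (Matrix.of fun i j : Fin 2 => if i.val + j.val + 1 = 2 then (1 : L) else 0)).Local v ×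
      (cmDatum L 1 (Matrix.of fun i j : Fin 1 => if i.val + j.val + 1 = 1 then (1 : L) else 0)).Local v),
      MeasurableSpace (((cmDatum L 2 (Matrix.of fun i j : Fin 2 => if i.val + j.val + 1 = 2 then (1 : L) else 0)).Local v ×
      (cmDatum L 1 (Matrix.of fun i j : Fin 1 => if i.val + j.val + 1 = 1 then (1 : L) else 0)).Local v) ⧸ Subgroup.centralizer ({a} : Set ((cmDatum L 2 (Matrix.of fun i j : Fin 2 => if i.val + j.val + 1 = 2 then (1 : L) else 0)).Local v ×
      (cmDatum L 1 (Matrix.of fun i j : Fin 1 => if i.val + j.val + 1 = 1 then (1 : L) else 0)).Local v)))]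
    (μ : HeckeCharacter L) (hμ : IsQuadraticCharExtension (conjLocal L (IsCMField.complexConj L) v) (μ.semilocalComponent L v))
    (hl : ∀ (v : HeightOneSpectrum (𝓞 ↥(maximalRealSubfield L)))
      (a : (cmDatum L 2 (Matrix.of fun i j : Fin 2 => if i.val + j.val + 1 = 2 then (1 : L) else 0)).Local v ×
      (cmDatum L 1 (Matrix.of fun i j : Fin 1 => if i.val + j.val + 1 = 1 then (1 : L) else 0)).Local v)
      (b : (cmDatum L 3 H).Local v)
      (x : (cmDatum L 2 (Matrix.of fun i j : Fin 2 => if i.val + j.val + 1 = 2 then (1 : L) else 0)).Local v ×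
      (cmDatum L 1 (Matrix.of fun i j : Fin 1 => if i.val + j.val + 1 = 1 then (1 : L) else 0)).Local v),
      finExplicitDelta L v H (x * a * x⁻¹) μ b = finExplicitDelta L v H a μ b)
    (hr : ∀ (v : HeightOneSpectrum (𝓞 ↥(maximalRealSubfield L)))
      (a : (cmDatum L 2 (Matrix.of fun i j : Fin 2 => if i.val + j.val + 1 = 2 then (1 : L) else 0)).Local v ×
      (cmDatum L 1 (Matrix.of fun i j : Fin 1 => if i.val + j.val + 1 = 1 then (1 : L) else 0)).Local v)
      (b y : (cmDatum L 3 H).Local v),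
      finExplicitDelta L v H a μ (y * b * y⁻¹) = finExplicitDelta L v H a μ b)
    (η ψ : ↥(normOneUnits (conjLocal L (IsCMField.complexConj L) v)) →* ℂˣ)
    (mH : OrbitalMeasureFamily ((cmDatum L 2 (Matrix.of fun i j : Fin 2 => if i.val + j.val + 1 = 2 then (1 : L) else 0)).Local v ×
      (cmDatum L 1 (Matrix.of fun i j : Fin 1 => if i.val + j.val + 1 = 1 then (1 : L) else 0)).Local v)) (mG : OrbitalMeasureFamily ((cmDatum L 3 H).Local v))
    {fH : ((cmDatum L 2 (Matrix.of fun i j : Fin 2 => if i.val + j.val + 1 = 2 then (1 : L) else 0)).Local v ×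
      (cmDatum L 1 (Matrix.of fun i j : Fin 1 => if i.val + j.val + 1 = 1 then (1 : L) else 0)).Local v) → ℂ}
    {f : (cmDatum L 3 H).Local v → ℂ} (htr : IsLocalDeltaTransfer L H v (finExplicitCollection L H μ hl hr v) mH mG fH f)
    {γH : ((cmDatum L 2 (Matrix.of fun i j : Fin 2 => if i.val + j.val + 1 = 2 then (1 : L) else 0)).Local v ×
      (cmDatum L 1 (Matrix.of fun i j : Fin 1 => if i.val + j.val + 1 = 1 then (1 : L) else 0)).Local v)}
    {d' : Fin 2 → (UnitaryGroup.LocalRing L v)ˣ} (hd' : glDiagonal 2 (UnitaryGroup.LocalRing L v) d' = (γH.1.val : GL (Fin 2) (UnitaryGroup.LocalRing L v)))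
    (hreg : IsLocalGRegular L v γH)
    (ha : IsUnit ((((d' 0)⁻¹ * (isUnit_finGammaTwo L v γH).unit : (UnitaryGroup.LocalRing L v)ˣ) : UnitaryGroup.LocalRing L v) - 1))
    (hb : IsUnit ((((d' 0)⁻¹ * d' 1 : (UnitaryGroup.LocalRing L v)ˣ) : UnitaryGroup.LocalRing L v) - 1))
    (hreg' : ∀ i j : Fin 3, i ≠ j → IsUnit (((![d' 0, (isUnit_finGammaTwo L v γH).unit, d' 1] i : (UnitaryGroup.LocalRing L v)ˣ) : UnitaryGroup.LocalRing L v) -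
      ((![d' 0, (isUnit_finGammaTwo L v γH).unit, d' 1] j : (UnitaryGroup.LocalRing L v)ˣ) : UnitaryGroup.LocalRing L v))) :
    ((torusCharPair (conjLocal L (IsCMField.complexConj L) v) (cmLocalForm L 2 v) (cmLocalForm_eq_over L 2 v) 0
          ((η.comp (quotConj (conjLocal L (IsCMField.complexConj L) v) (conjLocal_conjLocal_cm L v))) * halfModulusChar (UnitaryGroup.LocalRing L v)) ψ
          ⟨(γH.1 : ↥(unitaryGroupOfForm (conjLocal L (IsCMField.complexConj L) v) (cmLocalForm L 2 v))), fst_mem_torusU_of_glDiagonal_eq L v hd'⟩ : ℂˣ) : ℂ) *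
        ((ψ (localDet (IsCMField.complexConj L) v (isUnit_antidiagOne_det L 1) γH.2) : ℂˣ) : ℂ) *
        (haveI := locallyCompactSpace_cmBorelU L 2 v;
          ((rootDeltaChar (cmBorelTriple L 2 v).P
              ⟨(γH.1 : ↥(unitaryGroupOfForm (conjLocal L (IsCMField.complexConj L) v) (cmLocalForm L 2 v))),
                torusU_le_borelU _ _ (fst_mem_torusU_of_glDiagonal_eq L v hd')⟩ : ℂˣ) : ℂ)) *
        (((NNReal.sqrt (unitModulusChar (UnitaryGroup.LocalRing L v) hb.unit) : ℝ≥0) : ℝ) : ℂ) *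
        classOrbitalIntegral mH fH (ConjClasses.mk γH) =
      (if ∃ z : UnitaryGroup.LocalRing L v, IsUnit z ∧ a = z * conjLocal L (IsCMField.complexConj L) v z then (1 : ℂ) else -1) *
        (((cmXiTorusChar L v (μ.semilocalComponent L v) η ψ
              ⟨(endoEmbLocal L v γH : ↥(unitaryGroupOfForm (conjLocal L (IsCMField.complexConj L) v) (cmLocalForm L 3 v))),
                endoEmbLocal_mem_torusU_of_endoEmbLocal_eq L v γH (endoEmbLocal_eq_glDiagonal_of_fst_eq L v γH hd')⟩ : ℂˣ) : ℂ) *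
          (haveI := locallyCompactSpace_cmBorelU L 3 v;
            ((rootDeltaChar (cmBorelTriple L 3 v).P
                ⟨(endoEmbLocal L v γH : ↥(unitaryGroupOfForm (conjLocal L (IsCMField.complexConj L) v) (cmLocalForm L 3 v))),
                  torusU_le_borelU _ _ (endoEmbLocal_mem_torusU_of_endoEmbLocal_eq L v γH (endoEmbLocal_eq_glDiagonal_of_fst_eq L v γH hd'))⟩ : ℂˣ) : ℂ)) *
          (((unitModulusChar (UnitaryGroup.LocalRing L v) ha.unit * NNReal.sqrt (unitModulusChar (UnitaryGroup.LocalRing L v) hb.unit) : ℝ≥0) : ℝ) : ℂ) *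
          classOrbitalIntegral mG f (ConjClasses.mk (cmDatumLocalCongr L v T₀ ha₀ h (endoEmbLocal L v γH)))) := by
  have hι := endoEmbLocal_eq_glDiagonal_of_fst_eq L v γH hd'
  -- `u − d′₁` is a unit (the pair `(1, 2)` of `d = (d′₀, u, d′₁)`)
  have h12 : IsUnit (finGammaTwo L v γH - (d' 1 : UnitaryGroup.LocalRing L v)) := by
    have h := hreg' 1 2 (by decide)
    simp only [Matrix.cons_val_one, Matrix.cons_val_two, Matrix.head_cons, Matrix.tail_cons] at h
    exact h
  -- S3-A: one term; S3-B: `Δ‴ = τ · D · ε`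
  rw [classOrbitalIntegral_eq_delta_mul_classOrbitalIntegral_of_levi_cmDatumLocalCongr L H hH hHd T₀ ha₀ h (finExplicitCollection L H μ hl hr v) mH mG htr
      hd' hreg ha hb h12]
  simp only [finExplicitCollection_Δ]   -- (`rw` here times out: kabstract on the structure projection)
  rw [finExplicitDelta_cmDatumLocalCongr_endoEmbLocal_eq L H w hw T₀ ha₀ h μ γH hι hreg', int_cast_ite_one_neg_one]
  -- (L2) and (L3)
  have e1 := torusCharPair_mul_localDet_mul_finTau_eq_cmXiTorusChar L v μ hμ η ψ γH hd' ha
  have e2 := rootDeltaChar_two_mul_sqrt_mul_finWeylRatio_eq L v γH hd' ha hb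
  linear_combination
    ((haveI := locallyCompactSpace_cmBorelU L 2 v;
        ((rootDeltaChar (cmBorelTriple L 2 v).P
            ⟨(γH.1 : ↥(unitaryGroupOfForm (conjLocal L (IsCMField.complexConj L) v) (cmLocalForm L 2 v))),
              torusU_le_borelU _ _ (fst_mem_torusU_of_glDiagonal_eq L v hd')⟩ : ℂˣ) : ℂ)) *
      (((NNReal.sqrt (unitModulusChar (UnitaryGroup.LocalRing L v) hb.unit) : ℝ≥0) : ℝ) : ℂ) * (finWeylRatio L v γH : ℂ) *
      (if ∃ z : UnitaryGroup.LocalRing L v, IsUnit z ∧ a = z * conjLocal L (IsCMField.complexConj L) v z then (1 : ℂ) else -1) *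
      classOrbitalIntegral mG f (ConjClasses.mk (cmDatumLocalCongr L v T₀ ha₀ h (endoEmbLocal L v γH)))) * e1 +
    ((if ∃ z : UnitaryGroup.LocalRing L v, IsUnit z ∧ a = z * conjLocal L (IsCMField.complexConj L) v z then (1 : ℂ) else -1) *
      ((cmXiTorusChar L v (μ.semilocalComponent L v) η ψ
          ⟨(endoEmbLocal L v γH : ↥(unitaryGroupOfForm (conjLocal L (IsCMField.complexConj L) v) (cmLocalForm L 3 v))),
            endoEmbLocal_mem_torusU_of_endoEmbLocal_eq L v γH (endoEmbLocal_eq_glDiagonal_of_fst_eq L v γH hd')⟩ : ℂˣ) : ℂ) *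
      classOrbitalIntegral mG f (ConjClasses.mk (cmDatumLocalCongr L v T₀ ha₀ h (endoEmbLocal L v γH)))) * e2

end Summit.HodgeConjecture.HodgeConjecture.Cruxes.H413.F0P3bInducedCharTransferLeviIntegrand

end
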